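import Literature.MathematicalPhysics.QuantumFieldTheory.Balaban1985CMP102.SectB
import Summits.QuantumFields.Balaban3D.Carriers.Run
import Summits.QuantumFields.Balaban3D.Carriers.Regions

/-!
# Lane `pub-balaban3d` — carrier layer p1, part 8 (`Carriers.Tower`): the Sect. B tower objects of [Balaban1985UV3] INHABITED —
# `tower3` fills the spine's binder record `…Balaban1985CMP102.SectB.TowerObjects` (typer-1) with the constructed run (`run3`), the
# finite histories and the atomic large-field functional of `Carriers.Histories` (rulings R-HIST′/D-41), and PINS the (41)/(47) slot
# (ruling R-SLOT: two-stage construction, `SpecOK` by the spine's `specOK_pin`)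

WHAT IS CONSTRUCTED: from a `TowerInput` (the binders this layer does not construct — averaging family with `AvgAC`, thresholds,
[7]'s minimizers `U_k`/`U_k(·,h)`, the interaction sums `Pint` and the profiles `Estep`, `zcoef`, `rcoef` of the EXPANSION DATA
(ruling R-PIECES (d)), the masses `HistWeights` (D-p1-5), the tower parameters `M₁, R(g_j)M₁, b₀, p₀, κ₀`, the R-RN barriers):
`towerWith D slot : SectB.TowerObjects S G` (histories := `Hist S.P`, `LF := Carriers.LF`, volumes := the counts of §4 of
`Carriers.Histories`, `E := B10.Ek Estep K 0` — ruling R-E) and `tower3 D := (towerWith D _).pin`.  PROVED: `tower3_specOK :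
B10.SpecOK (tower3 D).toTowerRun` (the slot «ρ_k satisfies (41), (47)» MEANS the typed (41) ∧ (47) of this tower), `tower3_eq6`
((6) for the tower's run), `tower3_rho` (the tower's densities are `run3`'s).  Nothing of CMP 102 is asserted. [folklore]
-/

open MeasureTheory

namespace Summit.QuantumFields.Balaban3D.Carriers

open Literature.MathematicalPhysics.QuantumFieldTheory.Balaban1983to89
open Literature.MathematicalPhysics.QuantumFieldTheory.Balaban1985CMP102
open Literature.MathematicalPhysics.QuantumFieldTheory.Balaban1985CMP102.Setting

variable {L : ℕ} {S : Scales L} {G : Type} [GaugeGroup G] [MeasurableSpace G] [HaarData G]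

/-- `U_k(V)` for all `k` from the minimizers for `k ≥ 1`, with `U_0 = id` (ruling R-K0). [folklore] -/
def ukAll (Uk : (k : ℕ) → GaugeField S.P (k + 1) G → GaugeField S.P 0 G) : (k : ℕ) → GaugeField S.P k G → GaugeField S.P 0 G
  | 0 => id
  | k + 1 => Uk k

/-- THE INPUT OF THE TOWER CONSTRUCTION: everything the carrier layer takes as given (see the module docstring).  `E` and the
(41)/(47) slot are NOT inputs: `E := B10.Ek Estep K 0` (R-E) and the slot is pinned (R-SLOT). [cite: Balaban1985UV3, (38)–(43) p.266] -/
structure TowerInput {L : ℕ} (S : Scales L) (G : Type) [GaugeGroup G] [MeasurableSpace G] [HaarData G] where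
  /-- `ε₁` of (4)/(7), per step -/
  ε₁ : ℕ → ℝ
  /-- the averaging family `Ū` of [4] -/
  av : ∀ j, Averaging S.P j G
  /-- D-1a for every level -/
  avgAC : ∀ j, AvgAC (av j).avg
  /-- regular classes of [7] -/
  reg : ℕ → Set (GaugeField S.P 0 G)
  /-- minimizers `U_k(V)` of [7] Thm 1, `k ≥ 1` -/
  Uk : (k : ℕ) → GaugeField S.P (k + 1) G → GaugeField S.P 0 G
  /-- R-RN barriers -/
  lower : (k : ℕ) → Density S.P (k + 1) G
  /-- R-RN barriers -/
  upper : (k : ℕ) → Density S.P (k + 1) G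
  /-- `0 ≤ lower` -/
  lower_nonneg : ∀ k V, 0 ≤ lower k V
  /-- `0 ≤ upper` -/
  upper_nonneg : ∀ k V, 0 ≤ upper k V
  /-- big-block size `M₁` (sites of the unit lattice; (7) p. 257, (39) p. 266) -/
  M₁ : ℕ
  /-- collar profile `⌈R(g_j)⌉·M₁ = ⌈R₁ r(g_j)⌉·M₁` in scale-`j` units ((39) p. 266) -/
  Rcol : ℕ → ℕ
  /-- `b₀, p₀` of `p(g)` ((7) p. 257) -/
  b₀ : ℝ
  /-- `b₀, p₀` of `p(g)` ((7) p. 257) -/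
  p₀ : ℝ
  /-- `κ₀` of the remainders `O((L^jε)^{3+κ₀})` (p. 262 L3) -/
  κ₀ : ℝ
  /-- the masses of the histories ((41), fields integrated out; D-p1-5) -/
  W : HistWeights S.P G
  /-- the composite minimizer `U_k(V, h)` of (42) per history (expansion data) -/
  UkH : (k : ℕ) → Hist S.P k → GaugeField S.P k G → GaugeField S.P 0 G
  /-- at the trivial history it is `U_k(V)` ((42) with no large fields; R-K0 at `k = 0`) -/
  UkH_triv : ∀ (k : ℕ) (V : GaugeField S.P k G), UkH k (Hist.triv S.P k) V = ukAll Uk k V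
  /-- the interaction sum `Σ_{j≤k} Σ_{Y_j} 𝒫_j(Y_j, U_k)` of (43) per history (expansion data) -/
  Pint : (k : ℕ) → Hist S.P k → GaugeField S.P k G → ℝ
  /-- the coefficient profile of the `|Z_j|`-terms of (41) (booked: `CZ_j`, ruling R-PIECES (d)) -/
  zcoef : ℕ → ℝ
  /-- the coefficient profile of the remainder terms of (41)/(47) (booked: `CR·g^{6+2κ₀}`, R-NORM) -/
  rcoef : ℕ → ℝ
  /-- the vacuum-energy profile `E^{(j)}` of (62) (expansion data; R-E) -/
  Estep : ℕ → ℝ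

namespace TowerInput

variable (D : TowerInput S G)

/-- The run input of the tower: `E := E₀ = Σ_{j<K} E^{(j)}` ((64) p. 273, ruling R-E) and a given (41)/(47) slot. [cite: Balaban1985UV3, (64) p.273] -/
def toRunInput (slot : ℕ → Prop) : RunInput S G where
  E := B10.Ek D.Estep S.K 0
  ε₁ := D.ε₁
  av := D.av
  avgAC := D.avgAC
  reg := D.reg
  Uk := D.Uk
  ineq41_47 := slot
  lower := D.lower
  upper := D.upper
  lower_nonneg := D.lower_nonneg
  upper_nonneg := D.upper_nonneg

/-- `run3`'s `U_k` is `ukAll` (definitional, both cases). [folklore] -/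
theorem ukAll_eq (slot : ℕ → Prop) : ∀ (k : ℕ) (V : GaugeField S.P k G),
    (run3 (D.toRunInput slot)).Uk k V = ukAll D.Uk k V
  | 0, _ => rfl
  | _ + 1, _ => rfl

/-- STAGE 1 (ruling R-SLOT): the tower objects over the constructed run with a GIVEN slot. [cite: Balaban1985UV3, (38)–(43) p.266] -/
noncomputable def towerWith (slot : ℕ → Prop) : SectB.TowerObjects S G where
  toRunObjects := run3 (D.toRunInput slot)
  M₁ := D.M₁
  b₀ := D.b₀
  p₀ := D.p₀
  κ₀ := D.κ₀
  Hist := Hist S.P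
  triv := Hist.triv S.P
  LF := fun k V F => LF D.W k V F
  lf_mono := fun k V F F' h => lf_mono D.W k V F F' h
  lf_shift := fun k V F t => lf_shift D.W k V F t
  UkH := D.UkH
  UkH_triv := fun k V => by rw [D.UkH_triv, ukAll_eq]
  Pint := D.Pint
  Λvol := fun k h => min (LamVol D.M₁ D.Rcol k h : ℝ) (S.sites k)
  Λvol_le := fun k h => min_le_right _ _
  plaqsIn := fun k h => {p | plaqCover p ⊆ Omega D.M₁ D.Rcol k h k}
  plaqsIn_triv := fun k => by
    ext p
    simp only [Set.mem_setOf_eq, Set.mem_univ, iff_true]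
    rw [Omega_triv]
    exact Set.subset_univ _
  Zvol := fun k h j => (ZVol D.M₁ D.Rcol k h j : ℝ)
  Zvol_triv := fun k j => by simp [ZVol_triv]
  zcoef := D.zcoef
  rcoef := D.rcoef
  Estep := D.Estep
  E_eq := rfl

/-- STAGE 2 (ruling R-SLOT): pin the slot to the typed (41) ∧ (47) of the stage-1 tower (spine's `TowerObjects.pin`). [cite: Balaban1985UV3, (41)/(47) pp.266–267] -/
noncomputable def tower3 : SectB.TowerObjects S G := (D.towerWith fun _ => True).pin

/-- **`SpecOK` for the constructed tower**: «ρ_k satisfies (41), (47)» (the `RunData` slot Theorem 2 speaks about) IS the typed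
`B10.Ineq41 ∧ B10.Ineq47` of this tower (spine's `specOK_pin`). [cite: Balaban1985UV3, Thm 2 p.272] -/
theorem tower3_specOK : B10.SpecOK D.tower3.toTowerRun := SectB.TowerObjects.specOK_pin _

/-- The tower's densities are `run3`'s (pinning changes only the slot; propositional, by the spine's `pin_rho`). [folklore] -/
theorem tower3_rho (k : ℕ) : D.tower3.rho k = (run3 (D.toRunInput fun _ => True)).rho k :=
  SectB.TowerObjects.pin_rho _ k

/-- **(6) for the tower's run**. [cite: Balaban1985UV3, (6) p.257] -/
theorem tower3_eq6 [RegularGaugeGroup G] : D.tower3.toRunObjects.Eq6 := by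
  intro k hk
  show ∫ V, D.tower3.rho k V ∂(fieldMeasure S.P k G) = ∫ U, D.tower3.rho0 U ∂(fieldMeasure S.P 0 G)
  rw [tower3_rho]
  exact run3_eq6 (D.toRunInput fun _ => True) k hk

/-- **THE HONESTY COROLLARY AT TOWER LEVEL** (ruling R-RN; PLAN §0.5's «bounds5_ae_rnVersion», cf. `run3_bounds_ae_rnVersion`): any two-sided pointwise bound on the tower's `ρ_k` —
the stability bounds (5) once proved — holds dV-a.e. for the PLAIN iterated Radon–Nikodym version `Carriers.rhoSeq D.av ρ₀ k` of `T^kρ₀` (no version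
selection anywhere); seat p3 instantiates `lo`/`hi` with the two sides of (5). [cite: Balaban1985UV3, (5) p.256] -/
theorem tower3_bounds_ae_rnVersion (k : ℕ) {lo hi : Density S.P k G}
    (h : ∀ U, lo U ≤ D.tower3.rho k U ∧ D.tower3.rho k U ≤ hi U) :
    ∀ᵐ U ∂(fieldMeasure S.P k G),
      lo U ≤ rhoSeq D.av (wilsonStart S.P G S.g0sq (B10.Ek D.Estep S.K 0)) k U ∧
        rhoSeq D.av (wilsonStart S.P G S.g0sq (B10.Ek D.Estep S.K 0)) k U ≤ hi U :=
  run3_bounds_ae_rnVersion (D.toRunInput fun _ => True) k fun U => by rw [← tower3_rho]; exact h U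

/-- The k = 0 contract of the tower (ruling R-K0): one history, `LF 0 V F = exp (F triv)`. [folklore] -/
theorem tower3_lf_zero (V : GaugeField S.P 0 G) (F : Hist S.P 0 → ℝ) :
    D.tower3.LF 0 V F = Real.exp (F (Hist.triv S.P 0)) := lf_zero D.W V F

end TowerInput

end Summit.QuantumFields.Balaban3D.Carriers
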